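import Mathlib
import Summits.ValiantsHypothesis.ValiantsHypothesis.Theses.ElementaryWordLength
import Summits.ValiantsHypothesis.ValiantsHypothesis.Theorems.ElementaryWordLengthVpWordQpWords
import Literature.Computability.AlgebraicComplexity.ArithCircuitProofs
import Literature.Computability.AlgebraicComplexity.DepthReductionProofs
import Literature.Computability.AlgebraicComplexity.VPDeterminantalQPProofs

/-!
# Route `ElementaryWordLength`, item `VpWordQp` (stmt-ValiantsHypothesis-6628) — part 2:
`VP ⊆ VQF` in word form

**Claim settled** (`vpWordQp_proof`, literally the route decl
`Summit.ValiantsHypothesis.ValiantsHypothesis.Theses.ElementaryWordLength.VpWordQp`): for every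
`VP` family `f` over `ℂ` (variables `σ n`, finitely many) there is `c` such that for every `n` the
transvection `E_{13}(fₙ) = Matrix.transvection 0 2 (f n)` is the matrix of a word of at most
`2 ^ ((log₂ n + c) ^ c)` elementary letters `E_{ij}(λ)`, `E_{ij}(λ x_s)` (`i ≠ j`).

Proof = the Valiant–Skyum–Berkowitz–Rackoff / Hyafil stage recursion of
Bürgisser–Clausen–Shokrollahi 1997, Thm. (21.36), exactly as transcribed in the tree for
determinants (`Literature/.../VPDeterminantalQPProofs.lean`, `HasInvRepr`), with the Ben-Or–Cleve
word algebra of part 1 (`ElementaryWordLengthVpWordQpWords.lean`: `HasWordAt[i, j, g, m]`, a local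
notation) in place of inverse read-outs:

* `hasWordAt_aval` (stage recursion on the gate-quotient certificate `HomCircuit` of
  `GateQuotients.lean`): an atom of formal degree `≤ 2^j` has, at EVERY off-diagonal position,
  a word of length `≤ (2048 N)^j (#σ + 1)`, `N = #ι²` — stage `0` = affine letters, stage `j+1` =
  a sum of `≤ N` products of `≤ 5` earlier atoms (`expandAtom`; a product of `n` factors costs
  `4ⁿ (b + 1)` by the commutator rule);
* `hasWordAt_val`: a value of degree `≤ d` of a straight-line program of length `L` is the sum
  of its `d + 1` homogeneous components, nodes of `SLP.homogenize d` on `≤ S = 4L(d+1)²` nodes;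
* `stage_bound_le`, `exponent_le_pow`, `hasWordAt_of_complexity_le`: with
  `deg fₙ, L(fₙ), #σₙ + 1 < 2^E`, `E = (log₂ n + 1) A` (`IsPBounded.exists_lt_two_pow` on the three
  p-bounds of `IsVPFamily`), the length is `≤ 2^{23 E²} ≤ 2^{(log₂ n + c)^c}`, `c = 23 A² + 3`;
  circuits ↦ straight-line programs by `ArithCircuit.exists_computes_size_eq_complexity` and
  `DepthReduction.exists_slp` (gate-free outputs are single letters).

Unconditional (axioms `propext`, `Classical.choice`, `Quot.sound`). References:
[BenOrCleve1992] M. Ben-Or, R. Cleve, SIAM J. Comput. 21 (1992), Thm. 1;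
[ValiantSkyumBerkowitzRackoff1983]; [BurgisserClausenShokrollahi1997] §21.5, Thm. (21.36);
[Burgisser2000] Def. 2.26 (`VQP`).
-/

set_option linter.dupNamespace false

namespace Summit.ValiantsHypothesis.ValiantsHypothesis.Theorems

open Matrix MvPolynomial

/-- `wprod⟦w⟧` (local notation, not a definition; as in part 1): the matrix of a word `w`. -/
local notation3 (prettyPrint := false) "wprod⟦" w "⟧" => List.prod (List.map (fun l =>
  Matrix.transvection l.1 l.2.1 (MvPolynomial.C l.2.2.1 * l.2.2.2.elim 1 MvPolynomial.X)) w)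

/-- `HasWordAt[i, j, g, m]` (local notation, not a definition; as in part 1): `E_{ij}(g)` is the
matrix of a word of at most `m` off-diagonal elementary letters. -/
local notation3 (prettyPrint := false) "HasWordAt[" i ", " j ", " g ", " m "]" =>
  ∃ w : List (Fin 3 × Fin 3 × _ × Option _), List.length w ≤ m ∧ (∀ l ∈ w, l.1 ≠ l.2.1) ∧
    wprod⟦w⟧ = Matrix.transvection i j g

namespace VpWordQp

/-! ## The stage recursion (BCS 1997, Thm. (21.36), with words in place of determinants) -/

section Stages

open Literature.Computability.AlgebraicComplexity
open Literature.Computability.AlgebraicComplexity.DepthReduction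

variable {k : Type*} [CommRing k] {σ : Type*} [Fintype σ] {ι : Type*} [Fintype ι]
variable [DecidableEq ι]

/-- **The stage recursion for words**: an atom of formal degree `≤ 2^j` of a homogeneous circuit
certificate on `ι` has, at every off-diagonal position, a word of length
`≤ (2048 N)^j (#σ + 1)`, `N = #ι²` (stage `0`: affine atoms; stage `j + 1`: a sum of `≤ N`
products of `≤ 5` atoms of the previous stages, `expandAtom`). [folklore] -/
theorem hasWordAt_aval (H : HomCircuit k σ ι) : ∀ (j : ℕ) (a : HomCircuit.Atom ι),
    H.adeg a ≤ 2 ^ j → ∀ p q : Fin 3, p ≠ q →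
      HasWordAt[p, q, H.aval a,
        (2048 * (Fintype.card ι * Fintype.card ι)) ^ j * (Fintype.card σ + 1)] := by
  intro j
  induction j with
  | zero =>
    intro a ha p q hpq
    rw [pow_zero, one_mul]
    exact hasWordAt_of_totalDegree_le_one hpq ((H.totalDegree_aval_le a).trans (by simpa using ha))
  | succ j ih =>
    intro a ha p q hpq
    set N := Fintype.card ι * Fintype.card ι with hN
    set B := Fintype.card σ + 1 with hB
    have hN1 : 1 ≤ N := by
      have hne : Nonempty ι := by
        cases a with
        | node ν => exact ⟨ν⟩
        | quot ν μ => exact ⟨ν⟩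
      have := Fintype.card_pos_iff.2 hne
      exact Nat.one_le_iff_ne_zero.2 (Nat.mul_ne_zero (by omega) (by omega))
    have hb1 : 1 ≤ (2048 * N) ^ j * B :=
      Nat.one_le_iff_ne_zero.2 (Nat.mul_ne_zero (pow_ne_zero _ (by omega)) (by omega))
    by_cases h2 : 2 ≤ H.adeg a
    · rw [← H.expandAtom_sum h2]
      have hterm : ∀ T ∈ H.expandAtom a, ∀ p q : Fin 3, p ≠ q →
          HasWordAt[p, q, H.tval T, 1024 * ((2048 * N) ^ j * B + 1)] := by
        intro T hT p q hpq
        have hfac : ∀ f ∈ T.map H.aval, ∀ p q : Fin 3, p ≠ q →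
            HasWordAt[p, q, f, (2048 * N) ^ j * B] := by
          intro f hf p q hpq
          obtain ⟨b, hb, rfl⟩ := List.mem_map.1 hf
          refine ih b ?_ p q hpq
          have := H.expandAtom_half hT b hb
          rw [pow_succ] at ha
          omega
        have hprod := hasWordAt_list_prod hfac p q hpq
        rw [List.length_map] at hprod
        refine hasWordAt_mono hprod (Nat.mul_le_mul_right _ ?_)
        calc 4 ^ T.length ≤ 4 ^ 5 := Nat.pow_le_pow_right (by norm_num) (H.expandAtom_length_le hT)
          _ = 1024 := by norm_num
      have hsum : ∀ f ∈ (H.expandAtom a).map H.tval,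
          HasWordAt[p, q, f, 1024 * ((2048 * N) ^ j * B + 1)] := by
        intro f hf
        obtain ⟨T, hT, rfl⟩ := List.mem_map.1 hf
        exact hterm T hT p q hpq
      have := hasWordAt_list_sum hpq hsum
      rw [List.length_map] at this
      refine hasWordAt_mono this ?_
      calc (H.expandAtom a).length * (1024 * ((2048 * N) ^ j * B + 1))
          ≤ N * (1024 * ((2048 * N) ^ j * B + 1)) :=
            Nat.mul_le_mul_right _ (H.length_expandAtom_le a)
        _ ≤ N * (1024 * (2 * ((2048 * N) ^ j * B))) := by
            refine Nat.mul_le_mul_left _ (Nat.mul_le_mul_left _ ?_)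
            omega
        _ = (2048 * N) ^ (j + 1) * B := by ring
    · refine hasWordAt_mono (hasWordAt_of_totalDegree_le_one hpq
        ((H.totalDegree_aval_le a).trans (by omega))) ?_
      calc B = 1 * B := (one_mul B).symm
        _ ≤ (2048 * N) ^ (j + 1) * B :=
            Nat.mul_le_mul_right _ (Nat.one_le_pow _ _ (by omega))

/-- **Words for values of straight-line programs**: a value of total degree `≤ d` of a
straight-line program of length `L` has, at every off-diagonal position, a word of length
`≤ (d + 1) (2048 S²)^{log₂ d + 1} (#σ + 1)`, `S = 4L(d+1)²` (sum of the `d + 1` homogeneous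
components, which are nodes of the homogenized certificate). [folklore] -/
theorem hasWordAt_val (P : SLP k σ) (d : ℕ) {i : ℕ} (hi : i < P.len)
    (hd : (P.val i).totalDegree ≤ d) (p q : Fin 3) (hpq : p ≠ q) :
    HasWordAt[p, q, P.val i, (d + 1) *
      ((2048 * ((4 * P.len * (d + 1) ^ 2) * (4 * P.len * (d + 1) ^ 2))) ^ (Nat.log 2 d + 1) *
        (Fintype.card σ + 1))] := by
  classical
  rw [← sum_homogeneousComponent_of_le hd]
  have hcomp : ∀ e ∈ Finset.range (d + 1), HasWordAt[p, q, homogeneousComponent e (P.val i),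
      (2048 * ((4 * P.len * (d + 1) ^ 2) * (4 * P.len * (d + 1) ^ 2))) ^ (Nat.log 2 d + 1) *
        (Fintype.card σ + 1)] := by
    intro e he
    have he' : e < d + 1 := Finset.mem_range.1 he
    have hval : (P.homogenize d).aval (.node (⟨i, hi⟩, SLP.Tag.Q ⟨e, he'⟩)) =
        homogeneousComponent e (P.val i) := rfl
    rw [← hval]
    refine hasWordAt_mono (hasWordAt_aval (P.homogenize d) (Nat.log 2 d + 1) _ ?_ p q hpq)
      (Nat.mul_le_mul_right _ (Nat.pow_le_pow_left (Nat.mul_le_mul_left _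
        (Nat.mul_le_mul (P.card_node_le d) (P.card_node_le d))) _))
    show e ≤ 2 ^ (Nat.log 2 d + 1)
    exact (Nat.lt_succ_iff.1 he').trans (Nat.lt_pow_succ_log_self Nat.one_lt_two d).le
  have := hasWordAt_finset_sum hpq (Finset.range (d + 1)) hcomp
  rwa [Finset.card_range] at this

end Stages

/-! ## The quasi-polynomial bound -/

section Arithmetic

/-- The main estimate: if `d < 2^E`, `L ≤ 2^E`, `B ≤ 2^E` and `1 ≤ E`, then
`(d + 1) · (2048 (4L(d+1)²)²)^{log₂ d + 1} · B ≤ 2^{23 E²}`. [folklore] -/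
theorem stage_bound_le {d L B E : ℕ} (hd : d < 2 ^ E) (hL : L ≤ 2 ^ E) (hB : B ≤ 2 ^ E)
    (hE : 1 ≤ E) :
    (d + 1) * ((2048 * ((4 * L * (d + 1) ^ 2) * (4 * L * (d + 1) ^ 2))) ^ (Nat.log 2 d + 1) * B) ≤
      2 ^ (23 * E ^ 2) := by
  have hd1 : d + 1 ≤ 2 ^ E := hd
  have hS : 4 * L * (d + 1) ^ 2 ≤ 2 ^ (3 * E + 2) := by
    calc 4 * L * (d + 1) ^ 2 ≤ 4 * 2 ^ E * (2 ^ E) ^ 2 :=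
          Nat.mul_le_mul (Nat.mul_le_mul_left 4 hL) (Nat.pow_le_pow_left hd1 2)
      _ = 2 ^ (3 * E + 2) := by rw [← pow_mul, pow_add, pow_mul]; ring
  have hSS : 2048 * ((4 * L * (d + 1) ^ 2) * (4 * L * (d + 1) ^ 2)) ≤ 2 ^ (6 * E + 15) := by
    calc 2048 * ((4 * L * (d + 1) ^ 2) * (4 * L * (d + 1) ^ 2))
        ≤ 2 ^ 11 * (2 ^ (3 * E + 2) * 2 ^ (3 * E + 2)) :=
          Nat.mul_le_mul (by norm_num) (Nat.mul_le_mul hS hS)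
      _ = 2 ^ (6 * E + 15) := by rw [← pow_add, ← pow_add]; ring_nf
  have hlog : Nat.log 2 d + 1 ≤ E := by
    rcases Nat.eq_zero_or_pos d with rfl | hdpos
    · simpa using hE
    · exact Nat.succ_le_of_lt ((Nat.log_lt_iff_lt_pow Nat.one_lt_two hdpos.ne').2 hd)
  have hpow : (2048 * ((4 * L * (d + 1) ^ 2) * (4 * L * (d + 1) ^ 2))) ^ (Nat.log 2 d + 1) ≤
      2 ^ ((6 * E + 15) * E) := by
    calc (2048 * ((4 * L * (d + 1) ^ 2) * (4 * L * (d + 1) ^ 2))) ^ (Nat.log 2 d + 1)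
        ≤ (2 ^ (6 * E + 15)) ^ (Nat.log 2 d + 1) := Nat.pow_le_pow_left hSS _
      _ ≤ (2 ^ (6 * E + 15)) ^ E := Nat.pow_le_pow_right (Nat.one_le_two_pow) hlog
      _ = 2 ^ ((6 * E + 15) * E) := by rw [← pow_mul]
  calc (d + 1) * ((2048 * ((4 * L * (d + 1) ^ 2) * (4 * L * (d + 1) ^ 2))) ^ (Nat.log 2 d + 1) * B)
      ≤ 2 ^ E * (2 ^ ((6 * E + 15) * E) * 2 ^ E) :=
        Nat.mul_le_mul hd1 (Nat.mul_le_mul hpow hB)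
    _ = 2 ^ (E + ((6 * E + 15) * E + E)) := by rw [← pow_add, ← pow_add]
    _ ≤ 2 ^ (23 * E ^ 2) := Nat.pow_le_pow_right (by norm_num) (by nlinarith)

/-- The exponent bookkeeping: `23 A² (ℓ + 1)² ≤ (ℓ + c)^c` for `c = 23 A² + 3`. [folklore] -/
theorem exponent_le_pow (A ℓ : ℕ) :
    23 * ((ℓ + 1) * A) ^ 2 ≤ (ℓ + (23 * A ^ 2 + 3)) ^ (23 * A ^ 2 + 3) := by
  set c := 23 * A ^ 2 + 3 with hc
  have hc3 : 3 ≤ c := by omega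
  have hx : 1 ≤ ℓ + c := by omega
  calc 23 * ((ℓ + 1) * A) ^ 2 = 23 * A ^ 2 * (ℓ + 1) ^ 2 := by ring
    _ ≤ c * (ℓ + c) ^ 2 := Nat.mul_le_mul (by omega) (Nat.pow_le_pow_left (by omega) 2)
    _ ≤ (ℓ + c) * (ℓ + c) ^ 2 := Nat.mul_le_mul_right _ (by omega)
    _ = (ℓ + c) ^ 3 := by ring
    _ ≤ (ℓ + c) ^ c := Nat.pow_le_pow_right hx hc3

end Arithmetic

section Discharge

open Literature.Computability.AlgebraicComplexity
open Literature.Computability.AlgebraicComplexity.DepthReduction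

variable {k : Type*} [CommRing k] {σ : Type*} [Fintype σ]

/-- **Words from circuit complexity and degree**: if `deg g ≤ d < 2^E`, `L(g) ≤ 2^E`,
`#σ + 1 ≤ 2^E` and `1 ≤ E`, then `E_{pq}(g)` has a word of length `≤ 2^{23 E²}` at every
off-diagonal position (`exists_computes_size_eq_complexity`, `exists_slp`, `hasWordAt_val`;
gate-free outputs are one letter). [folklore] -/
theorem hasWordAt_of_complexity_le {g : MvPolynomial σ k} {d E : ℕ} (hdeg : g.totalDegree ≤ d)
    (hd : d < 2 ^ E) (hL : complexity g ≤ 2 ^ E) (hB : Fintype.card σ + 1 ≤ 2 ^ E) (hE : 1 ≤ E)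
    (p q : Fin 3) (hpq : p ≠ q) : HasWordAt[p, q, g, 2 ^ (23 * E ^ 2)] := by
  classical
  obtain ⟨P, hfan, hcomp, hsize⟩ := ArithCircuit.exists_computes_size_eq_complexity g
  obtain ⟨S, hlen, hcases⟩ := exists_slp P hfan
  rw [show P.eval = g from hcomp] at hcases
  have h1 : 1 ≤ 2 ^ (23 * E ^ 2) := Nat.one_le_two_pow
  rcases hcases with ⟨i, hi, hgi⟩ | ⟨j, hgj⟩ | ⟨c, hgc⟩
  · have hdi : (S.val i).totalDegree ≤ d := by rw [← hgi]; exact hdeg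
    have hw := hasWordAt_val S d hi hdi p q hpq
    rw [← hgi] at hw
    have hSlen : S.len ≤ 2 ^ E := by rw [hlen, hsize]; exact hL
    exact hasWordAt_mono hw (stage_bound_le hd hSlen hB hE)
  · rw [hgj]
    exact hasWordAt_mono (by simpa using hasWordAt_C_mul_X hpq (1 : k) j) h1
  · rw [hgc]
    exact hasWordAt_mono (hasWordAt_C hpq c) h1

end Discharge

end VpWordQp

open Literature.Computability.AlgebraicComplexity in
/-- **`VP ⊆ VQF` in word form** (item stmt-ValiantsHypothesis-6628, decl `VpWordQp` of route
`ElementaryWordLength`): every `VP` family `f` over `ℂ` has affine elementary words of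
quasi-polynomial length for the transvections `E_{13}(fₙ)`: there is `c` with a word of length
`≤ 2^{(log₂ n + c)^c}` for every `n`. Proof: the Valiant–Skyum–Berkowitz–Rackoff / Hyafil stage
recursion of Bürgisser–Clausen–Shokrollahi 1997, Thm. (21.36) (in-tree `GateQuotients`), composed
with the Ben-Or–Cleve word algebra (sums = concatenation, products = Steinberg commutators,
affine forms = `#σ + 1` letters), and the bookkeeping `deg fₙ, L(fₙ), #σₙ + 1 < 2^{(log₂ n + 1)A}`
⟹ length `≤ 2^{23 A² (log₂ n + 1)²} ≤ 2^{(log₂ n + c)^c}`, `c = 23 A² + 3`. -/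
theorem vpWordQp_proof :
    Summit.ValiantsHypothesis.ValiantsHypothesis.Theses.ElementaryWordLength.VpWordQp := by
  unfold Summit.ValiantsHypothesis.ValiantsHypothesis.Theses.ElementaryWordLength.VpWordQp
  intro σ _ f hf
  obtain ⟨⟨hvarp, hdegp⟩, hLp⟩ := hf
  obtain ⟨A₁, hA₁, hdeg⟩ := IsPBounded.exists_lt_two_pow hdegp
  obtain ⟨A₂, -, hL⟩ := IsPBounded.exists_lt_two_pow hLp
  obtain ⟨A₃, -, hV⟩ := IsPBounded.exists_lt_two_pow hvarp
  set A := A₁ + A₂ + A₃ with hA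
  refine ⟨23 * A ^ 2 + 3, fun n => ?_⟩
  set E := (Nat.log 2 n + 1) * A with hE
  have hE1 : 1 ≤ E := Nat.one_le_iff_ne_zero.2 (Nat.mul_ne_zero (by omega) (by omega))
  have hEd : (Nat.log 2 n + 1) * A₁ ≤ E := Nat.mul_le_mul_left _ (by omega)
  have hEL : (Nat.log 2 n + 1) * A₂ ≤ E := Nat.mul_le_mul_left _ (by omega)
  have hEV : (Nat.log 2 n + 1) * A₃ ≤ E := Nat.mul_le_mul_left _ (by omega)
  have hd : (f n).totalDegree < 2 ^ E :=
    (hdeg n).trans_le (Nat.pow_le_pow_right (by norm_num) hEd)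
  have hc : complexity (f n) ≤ 2 ^ E :=
    ((hL n).trans_le (Nat.pow_le_pow_right (by norm_num) hEL)).le
  have hv : Fintype.card (σ n) + 1 ≤ 2 ^ E :=
    (hV n).trans_le (Nat.pow_le_pow_right (by norm_num) hEV)
  obtain ⟨w, hw, ho, hp⟩ :=
    VpWordQp.hasWordAt_of_complexity_le le_rfl hd hc hv hE1 (0 : Fin 3) 2 (by decide)
  exact ⟨w, hw.trans (Nat.pow_le_pow_right (by norm_num) (VpWordQp.exponent_le_pow A _)), ho, hp⟩

end Summit.ValiantsHypothesis.ValiantsHypothesis.Theorems
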